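import Summits.QuantumFields.BalabanUV.T4Continuum.Support.NE7ExactCurrent
import Summits.QuantumFields.BalabanUV.T4Continuum.Support.NE3HessShapes
import Summits.QuantumFields.BalabanUV.T4Continuum.Support.NE3CurlStability
import Summits.QuantumFields.BalabanUV.T4Continuum.Support.NE3SlicePoincareShape
import HarnessLib

/-!
# NE7OneStepLetters — THE TWO LEFT-END LETTERS OF CONV-ONE-STEP FROM A TANGENT∕NORMAL SPLIT OF THE SEGMENT'S DIRECTION:
# the slop `−κ·dirSq X ≤ dAction U♯ X` from criticality on the tangent part and the plaquette radius of `U♯`, and the Poincaré letter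
# `m·dirSq X ≤ curlSq U♯ X` from (P♮) on the tangent part and the smallness of the normal part

Cell `pub-balaban`, rung (B)+1 sub-cell t4, lineage `b2b-balaban-t4-ne7-p1`, generation 66 (CRUX PROVER NE7 #1); hunt (h10) «ONE-STEP = CRIT ∧ CONV»,
memo `t4/b2b-balaban-t4-ne7-p1-g66/HUNT-H10-TWO-ROADS.md` §2.  File F3 (after F1 `NE7OneStepOfCritical`, F2 `NE7SegmentPlaquetteRadius`).

WHY.  F1's `isMinimiser_of_poincare_slop` turns CONV-ONE-STEP (a critical small-field configuration `U♯` is a GLOBAL constrained minimiser —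
reading D-B11-2 of [Balaban1985Variational] Thm 1 (8) + Prop. 7) into: for every competitor `U′ ∼ U♯e^{X}` (i) a POINCARÉ LETTER for the segment's
direction `m·dirSq X ≤ curlSq U♯ X`, (ii) the radius along the segment (F2), (iii) a SLOP LETTER `−κ·dirSq X ≤ dAction U♯ X`, and a numeric line.
The direction `X` of a competitor is NOT tangent to the constraint fibre (the fibre is curved) and NOT gauge-fixed; what the suppliers control is a
split `X = X_T + X_N` — `X_T` in the block-Landau tangent slice `T_♮(U♯)` (where row NE3's k-uniform class-level (P♮)_W
`NE3ClassSlicePoincare.classSlicePoincare_of_lines` holds and where a critical `U♯` has `dAction U♯ X_T = 0`), `X_N` the NORMAL remainder, quadratically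
small in `X` (second-order remainder of Bałaban's average; [Balaban1985Variational] Prop. 2 TYPE for the sup of `X`).  THIS FILE derives (i) and
(iii) from that split, so that CONV-ONE-STEP's residual is literally: the split with its two smallness letters, criticality on `X_T`, (P♮)_W.
§1 **`abs_dAction_le_radius_mul`** — at a unitary `U` with `SmallField U a` and skew `Y`: `|dAction U Y W| ≤ a·Σ_{p∈W} ‖(d_U Y)(p)‖` (the dressed
   curl is skew, so `Re tr (d_U Y)(p) = 0` and only `U(∂p) − 1` pairs: the first variation at a small-field configuration is small in `ℓ¹` of the
   curl — the mechanism behind «the Lagrange multiplier is O(curvature)»);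
§2 **`dAction_ge_of_tangent_critical`** — `X = X_T + X_N`, `dAction U X_T W = 0` ⟹ `−a·Σ_{p∈W}‖(d_U X_N)(p)‖ ≤ dAction U X W`; with the normal
   letter `Σ_{p∈W}‖(d_U X_N)(p)‖ ≤ C_N·dirSq X F`: **`slop_of_tangent_critical`** `−(a·C_N)·dirSq X F ≤ dAction U X W` — F1's slop with `κ = a·C_N`;
§3 **`curlSq_ge_of_tangent_normal`** — `X = X_T + X_N` on the torus window `periodBox M`, `X_N` `M`-periodic, a Poincaré bound
   `m_T·dirSq X_T ≤ curlSq U X_T` (`m_T ≥ 0`) and the normal letter `dirSq X_N ≤ θ·dirSq X` ⟹ `(m_T∕4 − (m_T∕2 + 16d)·θ)·dirSq X ≤ curlSq U X`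
   (`‖a + b‖² ≥ ‖a‖²∕2 − ‖b‖²` twice and the torus bond count `NE3HessShapes.sum_plaqsOf_bondSq_le`); **`curlSq_ge_of_slicePoincare`** — the same
   with `m_T = (L^k)^{−2}∕C` read off row NE3's shape `NE3SlicePoincareShape.SlicePoincare L k U T C (periodBox M)` for `X_T ∈ T` — F1's Poincaré
   letter with `m = (L^k)^{−2}∕(4C) − ((L^k)^{−2}∕(2C) + 16d)·θ`, k-UNIFORMLY POSITIVE as soon as `θ·(L^k)²` is small against `1∕(C·d)`, which is
   the scale the quadratic normal letter delivers for `‖X‖_∞ = O(ε·L^{−k})` (memo H10 §2 (d)).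
HONEST FRAMING (page 1): [folklore] inequalities over HYPOTHESES (the split, its letters, criticality on `X_T`, (P♮) for `X_T`); nothing is asserted
about Bałaban's minimisers; 0 def, 0 sorry; NOT ONE-STEP, NOT NE7; spine 0∕9; finite T⁴ rung (B)+1 — NOT infinite volume, NOT mass gap, NOT Clay.
Continuum YM on T⁴ ⇐ BetaPertH ∧ nine spine estimates (0/9 proved); BetaPertH ⇐ (D1) ∧ (D4) ∧ CAP+tail; G-an2-4 gates asym, D1 and NE2/3/4.
-/

set_option autoImplicit false

open scoped BigOperators Matrix.Norms.L2Operator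
open NormedSpace Finset Set

namespace Summit.QuantumFields.BalabanUV.T4Continuum.NE7OneStepLetters

open Literature.MathematicalPhysics.QuantumFieldTheory.Balaban1983to89
open B7Prop1Explicit B7Prop2Explicit MatrixLog UnitaryModel
open T4AveragingDeficitWall (IsUnitaryCfg IsSkewDir SmallField fineAction vary curl curlAt curlSq dirSq fhol)
open T4AveragingDeficitWallBoundary (periodBox)
open AveragingDeficitPeriodicCounting (IsPeriodicDir)
open AveragingDeficitTransport (nReTr_eq_zero_of_mem_skewAdjoint)
open AveragingDeficitNearIdentity (abs_nReTr_mul_le)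
open NE3HessForm (dAction)
open NE3HessBounds (bondSq bondSqAt curlAt_mem_skewAdjoint norm_curlAt_sq_le)
open NE3HessShapes (plaqsOf sum_plaqsOf_bondSq_le curlSq_eq_sum_plaqsOf sum_plaqsOf)
open NE3CurlStability (norm_sq_half_sub_le)
open NE3PureGaugeFirstVariation (curl_add)
open NE3SlicePoincareShape (SlicePoincare)
open NE7ExactCurrent (dAction_add)

noncomputable section

variable {d : ℕ} {n : Type*} [Fintype n] [DecidableEq n]

/-! ## §1 The first variation at a small-field configuration is small in `ℓ¹` of the dressed curl -/

/-- **`|dAction U Y W| ≤ a·Σ_{p∈W} ‖(d_U Y)(p)‖`** for unitary `U` with `SmallField U a` and skew `Y`: the dressed curl is skew (`Re tr = 0`), so in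
`−Re tr[(d_U Y)(p)·U(∂p)] = −Re tr[(d_U Y)(p)·(U(∂p) − 1)]` only the plaquette defect pairs. [folklore] -/
theorem abs_dAction_le_radius_mul [Nonempty n] {U : Site d → Fin d → (Matrix n n ℂ)ˣ} (hU : IsUnitaryCfg U)
    {Y : Site d → Fin d → Matrix n n ℂ} (hY : IsSkewDir Y) {a : ℝ} (hUa : SmallField U a) (W : Finset (T4AveragingDeficitWall.Plaq d)) :
    |dAction U Y W| ≤ a * ∑ p ∈ W, ‖curl U Y p‖ := by
  unfold dAction
  rw [abs_neg, Finset.mul_sum]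
  refine (Finset.abs_sum_le_sum_abs _ _).trans (Finset.sum_le_sum fun p _ => ?_)
  have hskew : nReTr (curl U Y p) = 0 :=
    nReTr_eq_zero_of_mem_skewAdjoint (curlAt_mem_skewAdjoint hU hY p.1 p.2.1.1 p.2.1.2)
  have hsplit : curl U Y p * ((fhol U p : (Matrix n n ℂ)ˣ) : Matrix n n ℂ)
      = curl U Y p * (((fhol U p : (Matrix n n ℂ)ˣ) : Matrix n n ℂ) - 1) + curl U Y p := by noncomm_ring
  have hlin : nReTr (curl U Y p * ((fhol U p : (Matrix n n ℂ)ˣ) : Matrix n n ℂ))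
      = nReTr (curl U Y p * (((fhol U p : (Matrix n n ℂ)ˣ) : Matrix n n ℂ) - 1)) + nReTr (curl U Y p) := by
    rw [hsplit, ← T4AveragingDeficitWall.nReTrL_apply, map_add, T4AveragingDeficitWall.nReTrL_apply, T4AveragingDeficitWall.nReTrL_apply]
  rw [hlin, hskew, add_zero]
  have hp : ‖((fhol U p : (Matrix n n ℂ)ˣ) : Matrix n n ℂ) - 1‖ ≤ a := hUa p.1 p.2.1.1 p.2.1.2 (ne_of_lt p.2.2)
  calc |nReTr (curl U Y p * (((fhol U p : (Matrix n n ℂ)ˣ) : Matrix n n ℂ) - 1))|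
      ≤ ‖curl U Y p‖ * ‖((fhol U p : (Matrix n n ℂ)ˣ) : Matrix n n ℂ) - 1‖ := abs_nReTr_mul_le _ _
    _ ≤ ‖curl U Y p‖ * a := mul_le_mul_of_nonneg_left hp (norm_nonneg _)
    _ = a * ‖curl U Y p‖ := mul_comm _ _

/-! ## §2 The slop letter from criticality on the tangent part -/

/-- **SLOP FROM TANGENT CRITICALITY**: for unitary `U` with `SmallField U a`, a split `X = X_T + X_N` with `X_N` skew and `dAction U X_T W = 0`
(criticality of `U` along the tangent part — for an interior constrained minimiser the tree's `NE7MinimiserTensionPairing.critical_of_interior_isMinimiser`;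
for CRIT-ONE-STEP a hypothesis on the constructed configuration): `−a·Σ_{p∈W}‖(d_U X_N)(p)‖ ≤ dAction U X W`. [folklore] -/
theorem dAction_ge_of_tangent_critical [Nonempty n] {U : Site d → Fin d → (Matrix n n ℂ)ˣ} (hU : IsUnitaryCfg U) {a : ℝ} (hUa : SmallField U a)
    {X XT XN : Site d → Fin d → Matrix n n ℂ} (hsplit : X = XT + XN) (hXN : IsSkewDir XN) (W : Finset (T4AveragingDeficitWall.Plaq d))
    (hcrit : dAction U XT W = 0) :
    -(a * ∑ p ∈ W, ‖curl U XN p‖) ≤ dAction U X W := by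
  rw [hsplit, dAction_add, hcrit, zero_add]
  have h := abs_dAction_le_radius_mul hU hXN hUa W
  linarith [neg_abs_le (dAction U XN W)]

/-- **THE SLOP LETTER OF F1** (`isMinimiser_of_poincare_slop`'s `−κ·dirSq X ≤ dAction U♯ X`): with the NORMAL LETTER
`Σ_{p∈W}‖(d_U X_N)(p)‖ ≤ C_N·dirSq X F` (quadratic smallness of the normal part — [Balaban1985Variational] Prop. 2 TYPE with the second-order
remainder of the average; a HYPOTHESIS) and `a ≥ 0`: `−(a·C_N)·dirSq X F ≤ dAction U X W`. [folklore] -/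
theorem slop_of_tangent_critical [Nonempty n] {U : Site d → Fin d → (Matrix n n ℂ)ˣ} (hU : IsUnitaryCfg U) {a : ℝ} (ha : 0 ≤ a)
    (hUa : SmallField U a) {X XT XN : Site d → Fin d → Matrix n n ℂ} (hsplit : X = XT + XN) (hXN : IsSkewDir XN)
    (W : Finset (T4AveragingDeficitWall.Plaq d)) (F : Finset (Site d)) (hcrit : dAction U XT W = 0) {CN : ℝ}
    (hN1 : ∑ p ∈ W, ‖curl U XN p‖ ≤ CN * dirSq X F) :
    -(a * CN * dirSq X F) ≤ dAction U X W := by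
  have h := dAction_ge_of_tangent_critical hU hUa hsplit hXN W hcrit
  have h2 : a * ∑ p ∈ W, ‖curl U XN p‖ ≤ a * (CN * dirSq X F) := mul_le_mul_of_nonneg_left hN1 ha
  linarith

/-! ## §3 The Poincaré letter for the segment's direction from (P♮) on the tangent part -/

/-- `‖a‖²∕2 − ‖b‖² ≤ ‖a + b‖²` (matrices). [folklore] -/
theorem norm_add_sq_ge (a b : Matrix n n ℂ) : ‖a‖ ^ 2 / 2 - ‖b‖ ^ 2 ≤ ‖a + b‖ ^ 2 :=
  norm_sq_half_sub_le (by simpa using norm_le_add_norm_add a b)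

/-- `dirSq (X_T + X_N) F ≥ dirSq X_T F ∕2 − dirSq X_N F`. [folklore] -/
theorem dirSq_add_ge (XT XN : Site d → Fin d → Matrix n n ℂ) (F : Finset (Site d)) :
    dirSq XT F / 2 - dirSq XN F ≤ dirSq (XT + XN) F := by
  unfold dirSq
  rw [Finset.sum_div, ← Finset.sum_sub_distrib]
  refine Finset.sum_le_sum fun x _ => ?_
  rw [Finset.sum_div, ← Finset.sum_sub_distrib]
  exact Finset.sum_le_sum fun κ _ => norm_add_sq_ge (XT x κ) (XN x κ)

/-- `curlSq U (X_T + X_N) F ≥ curlSq U X_T F ∕2 − curlSq U X_N F` (the dressed curl is additive in the direction). [folklore] -/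
theorem curlSq_add_ge (U : Site d → Fin d → (Matrix n n ℂ)ˣ) (XT XN : Site d → Fin d → Matrix n n ℂ) (F : Finset (Site d)) :
    curlSq U XT F / 2 - curlSq U XN F ≤ curlSq U (XT + XN) F := by
  rw [curlSq_eq_sum_plaqsOf, curlSq_eq_sum_plaqsOf, curlSq_eq_sum_plaqsOf, Finset.sum_div, ← Finset.sum_sub_distrib]
  refine Finset.sum_le_sum fun p _ => ?_
  rw [curl_add]
  exact norm_add_sq_ge _ _

/-- `curlSq U X_N (periodBox M) ≤ 16d·dirSq X_N (periodBox M)` for unitary `U` and `M`-periodic `X_N` (`M ≥ 1`): `‖d_U Y‖² ≤ 4·bondSq Y` and the torus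
bond count. [folklore] -/
theorem curlSq_le_dirSq {M : ℕ} (hM : 1 ≤ M) {U : Site d → Fin d → (Matrix n n ℂ)ˣ} (hU : IsUnitaryCfg U)
    {XN : Site d → Fin d → Matrix n n ℂ} (hXNP : IsPeriodicDir XN M) :
    curlSq U XN (periodBox (d := d) M) ≤ 16 * d * dirSq XN (periodBox (d := d) M) := by
  rw [curlSq_eq_sum_plaqsOf]
  have hb := sum_plaqsOf_bondSq_le (n := n) hM hXNP
  calc ∑ p ∈ plaqsOf (periodBox (d := d) M), ‖curl U XN p‖ ^ 2
      ≤ ∑ p ∈ plaqsOf (periodBox (d := d) M), 4 * bondSq XN p :=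
        Finset.sum_le_sum fun p _ => norm_curlAt_sq_le hU XN p.1 p.2.1.1 p.2.1.2
    _ = 4 * ∑ p ∈ plaqsOf (periodBox (d := d) M), bondSq XN p := by rw [Finset.mul_sum]
    _ ≤ 4 * (4 * d * dirSq XN (periodBox (d := d) M)) := by linarith
    _ = 16 * d * dirSq XN (periodBox (d := d) M) := by ring

/-- **THE POINCARÉ LETTER FROM THE SPLIT.**  Unitary `U`, `X = X_T + X_N` with `X_N` `M`-periodic (`M ≥ 1`), a Poincaré bound for the TANGENT part
`m_T·dirSq X_T ≤ curlSq U X_T` on `periodBox M` with `m_T ≥ 0`, and the NORMAL LETTER `dirSq X_N ≤ θ·dirSq X` there ⟹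
`(m_T∕4 − (m_T∕2 + 16d)·θ)·dirSq X ≤ curlSq U X` on `periodBox M`. [folklore] -/
theorem curlSq_ge_of_tangent_normal {M : ℕ} (hM : 1 ≤ M) {U : Site d → Fin d → (Matrix n n ℂ)ˣ} (hU : IsUnitaryCfg U)
    {X XT XN : Site d → Fin d → Matrix n n ℂ} (hsplit : X = XT + XN) (hXNP : IsPeriodicDir XN M) {mT θ : ℝ} (hmT : 0 ≤ mT)
    (hPT : mT * dirSq XT (periodBox (d := d) M) ≤ curlSq U XT (periodBox (d := d) M))
    (hN2 : dirSq XN (periodBox (d := d) M) ≤ θ * dirSq X (periodBox (d := d) M)) :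
    (mT / 4 - (mT / 2 + 16 * d) * θ) * dirSq X (periodBox (d := d) M) ≤ curlSq U X (periodBox (d := d) M) := by
  have h1 := curlSq_add_ge U XT XN (periodBox (d := d) M)
  rw [← hsplit] at h1
  -- `dirSq X_T ≥ dirSq X ∕2 − dirSq X_N` from `X_T = X + (−X_N)`
  have hTeq : X + -XN = XT := by rw [hsplit]; abel
  have hneg : dirSq (-XN) (periodBox (d := d) M) = dirSq XN (periodBox (d := d) M) := by
    unfold dirSq; simp only [Pi.neg_apply, norm_neg]
  have h2 := dirSq_add_ge X (-XN) (periodBox (d := d) M)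
  rw [hTeq, hneg] at h2
  have h3 := curlSq_le_dirSq hM hU hXNP
  have h4 : mT * (dirSq X (periodBox (d := d) M) / 2 - dirSq XN (periodBox (d := d) M)) ≤ curlSq U XT (periodBox (d := d) M) :=
    (mul_le_mul_of_nonneg_left h2 hmT).trans hPT
  have hd : (0 : ℝ) ≤ d := Nat.cast_nonneg d
  have h5 : (mT / 2 + 16 * d) * dirSq XN (periodBox (d := d) M) ≤ (mT / 2 + 16 * d) * (θ * dirSq X (periodBox (d := d) M)) :=
    mul_le_mul_of_nonneg_left hN2 (by positivity)
  nlinarith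

/-- **F1's POINCARÉ LETTER FROM ROW NE3's (P♮) SHAPE**: if `SlicePoincare L k U T C (periodBox M)` (`(L^k)^{−2}·dirSq Y ≤ C·curlSq U Y` for `Y ∈ T`,
`C > 0`) and `X = X_T + X_N` with `X_T ∈ T`, `X_N` `M`-periodic, `dirSq X_N ≤ θ·dirSq X`, then
`((L^k)^{−2}∕(4C) − ((L^k)^{−2}∕(2C) + 16d)·θ)·dirSq X ≤ curlSq U X` on `periodBox M` — positive, k-UNIFORMLY in units of `(L^k)^{−2}`, as soon as
`θ·(L^k)²·(1∕(2C) + 16d·(L^k)²… )` — precisely: `θ < 1∕(4C·(1∕(2C) + 16d·(L^k)²))` — i.e. `θ·(L^k)² = o(1∕(C·d))`. [folklore] -/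
theorem curlSq_ge_of_slicePoincare {L k M : ℕ} (hM : 1 ≤ M) {U : Site d → Fin d → (Matrix n n ℂ)ˣ} (hU : IsUnitaryCfg U)
    {T : Set (Site d → Fin d → Matrix n n ℂ)} {C : ℝ} (hC : 0 < C) (hP : SlicePoincare L k U T C (periodBox (d := d) M))
    {X XT XN : Site d → Fin d → Matrix n n ℂ} (hsplit : X = XT + XN) (hXT : XT ∈ T) (hXNP : IsPeriodicDir XN M) {θ : ℝ}
    (hN2 : dirSq XN (periodBox (d := d) M) ≤ θ * dirSq X (periodBox (d := d) M)) :
    (((((L : ℝ) ^ k)⁻¹) ^ 2 / C) / 4 - (((((L : ℝ) ^ k)⁻¹) ^ 2 / C) / 2 + 16 * d) * θ) * dirSq X (periodBox (d := d) M)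
      ≤ curlSq U X (periodBox (d := d) M) := by
  have hPT0 := hP XT hXT
  have hmT : 0 ≤ ((((L : ℝ) ^ k)⁻¹) ^ 2 / C) := by positivity
  have hPT : ((((L : ℝ) ^ k)⁻¹) ^ 2 / C) * dirSq XT (periodBox (d := d) M) ≤ curlSq U XT (periodBox (d := d) M) := by
    rw [div_mul_eq_mul_div, div_le_iff₀ hC]
    linarith [mul_comm C (curlSq U XT (periodBox (d := d) M))]
  exact curlSq_ge_of_tangent_normal hM hU hsplit hXNP hmT hPT hN2

end

end Summit.QuantumFields.BalabanUV.T4Continuum.NE7OneStepLetters
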